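import Mathlib
import HarnessLib
import Literature.MathematicalPhysics.QuantumLattice.HubbardUVCovarianceCTTimeMoment
import Summits.HubbardSuperconductivity.HubbardSuperconductivity.Theorems.KLProgrammeKLRegimeEngineScaleZeroMixedDecay

/-!
# Route `KLProgramme`, crux K3 child ENGINE (`KLRegimeEngineV14`, stmt-HubbardSuperconductivity-19918), stub `stub_engine_scale0`, conjunct (E4)₀:
# the TIME MOMENT of the scale-`0` covariance of an admissible frame is `O(1)` in the grid units, uniformly in `M`, `β`, `L`

Cell gate-hubbard-kl, seat hubbard-kl-k3c4-p2 (the time part `A_T` of the weighted decay constant `α_w` of (E4)₀, k3c2-p1's design of record).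
For the character sum `S[G](a,b⃗) = Σ_{q₀,q⃗} χ_{q₀}(a)χ_{q⃗}(b⃗)G(q₀,q⃗)` of the padded symbol `G = gridSymbol L M N β (uvSymbolCT L M β μ K klE0) σ` of the
scale-`0` covariance `C^K_{>e₀}` on an `N`-point time grid (`2M ≤ N`; the engine's `N = 2(2M)`), the Literature side
(`HubbardUVCovarianceCTTimeMoment.timeMoment_charSum_uvSymbolCT_le`: weighted Plancherel with the monomial `4|ã|/N`, product weight at time
scale `⌈N/(β e₀)⌉` and space scale `R`, the eight mixed-difference `ℓ²` norms of `HubbardUVSymbolCTMixedDifferences`) gives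
`(β/N)·Σ_{a,b⃗} (β/N)|ã|·‖S[G](a,b⃗)‖ ≤ uvTimeMomentConst e₀ D R` for `2 ≤ β`, `β³ ≤ M`.  Here `D = 7` (`uvSurfaceBound_of_frameOK`), `e₀ = klE0`,
`R = 32 = 1/e₀`, and `β³ ≤ M` comes from the engine's thresholds (`pow_three_le_of_klEng`).  The constant `uvTimeMomentConst klE0 7 32` is a
closed term (no staged binder; (R7)-legal).  What remains for `α_w` on the consumer's side: the grid-leg reduction «weighted row sum ≤ weighted
torus sum» (twin of `HubbardGridCharacters.sum_norm_gridSub_pullback_row_le`) and the space moments.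

* **`timeMoment_scaleZero_of_frameOK`** — under `FrameOK`, `klBetaMin ≤ β`, `β³ ≤ M`, `2M ≤ N`;
* **`timeMoment_scaleZero_of_klEng`** — the same under `klEngL₃ β U ≤ L`, `klEngM₃ β U L ≤ M`.
-/

noncomputable section

namespace Summit.HubbardSuperconductivity.HubbardSuperconductivity.Theorems.ScaleZeroDecay

set_option linter.dupNamespace false -- summit = problem name (single-conjunct summit), D-0017

open Real Finset Literature.MathematicalPhysics.QuantumLattice Literature.Probability.LatticeModels
open Literature.MathematicalPhysics.QuantumLattice.FermiRG
open Summit.HubbardSuperconductivity.HubbardSuperconductivity.Theorems.KLRegimeSplit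
open Summit.HubbardSuperconductivity.HubbardSuperconductivity.Theorems.DispersionFlow
open Summit.HubbardSuperconductivity.HubbardSuperconductivity.Theorems.EngineV8

variable {R : RenConsts} {U : ℝ} {Nsc : ℕ} {μ : ℝ} {K : TrigPolyC4v} {β : ℝ} {L M N : ℕ} [NeZero L] [NeZero N]

/-- **The time moment of the scale-`0` covariance of an admissible frame is `O(1)` in the grid units**: for `FrameOK`, `klBetaMin ≤ β`,
`β³ ≤ M`, `2M ≤ N`, every spin `σ`,
`(β/N)·Σ_{a,b⃗} (β/N)·|ã|·‖Σ_{q₀,q⃗} χ_{q₀}(a)χ_{q⃗}(b⃗)·gridSymbol(uvSymbolCT … klE0) σ q₀ q⃗‖ ≤ uvTimeMomentConst klE0 7 32` — uniform in `M`, `β`,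
`L`, `μ`, `U`, the frame. -/
theorem timeMoment_scaleZero_of_frameOK (hK : FrameOK R U Nsc μ K) (hβ : klBetaMin ≤ β) (hβM : β ^ 3 ≤ (M : ℝ)) (hMN : 2 * M ≤ N)
    (σ : Fin 2) :
    β / N * ∑ a : TorusSite 1 N, ∑ bv : TorusSite 2 L,
        β / N * |(((a 0).valMinAbs : ℤ) : ℝ)| *
          ‖∑ q₀ : TorusSite 1 N, ∑ qv : TorusSite 2 L,
            torusChar q₀ a * torusChar qv bv * gridSymbol L M N β (uvSymbolCT L M β μ K klE0) σ q₀ qv‖ ≤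
      uvTimeMomentConst klE0 7 32 := by
  have hβ2 : (2 : ℝ) ≤ β := le_trans (by norm_num [klBetaMin]) hβ
  exact timeMoment_charSum_uvSymbolCT_le hβ2 (by norm_num [klE0]) (by norm_num) (uvSurfaceBound_of_frameOK hK) hβM hMN
    (by norm_num) σ

/-- **The same under the engine's thresholds** `klEngL₃ β U ≤ L`, `klEngM₃ β U L ≤ M` (which give `β³ ≤ M`). -/
theorem timeMoment_scaleZero_of_klEng (hK : FrameOK R U Nsc μ K) (hβ : klBetaMin ≤ β) (hL : klEngL₃ β U ≤ L)
    (hM : klEngM₃ β U L ≤ M) (hMN : 2 * M ≤ N) (σ : Fin 2) :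
    β / N * ∑ a : TorusSite 1 N, ∑ bv : TorusSite 2 L,
        β / N * |(((a 0).valMinAbs : ℤ) : ℝ)| *
          ‖∑ q₀ : TorusSite 1 N, ∑ qv : TorusSite 2 L,
            torusChar q₀ a * torusChar qv bv * gridSymbol L M N β (uvSymbolCT L M β μ K klE0) σ q₀ qv‖ ≤
      uvTimeMomentConst klE0 7 32 :=
  timeMoment_scaleZero_of_frameOK hK hβ (pow_three_le_of_klEng hβ hL hM) hMN σ

end Summit.HubbardSuperconductivity.HubbardSuperconductivity.Theorems.ScaleZeroDecay

end
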